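import Mathlib
import HarnessLib.Audit
import Summits.PneNP.PneNP.Theorems.PstarNorUnitEQ1Three
import Summits.PneNP.PneNP.Theorems.PstarNorUnitMixed
import Summits.PneNP.PneNP.Theorems.PstarChordBridgeCornerUnit

/-!
# The direction picture gives at most five outputs; every terminal core has `#J₀ ≤ 5` (ROUND-24, memo §9 R5–R9; typing step (T2))

FRONTIER range-avoidance ladder, rung F-N3, ROUND 24 (cell `pnp-ideate`, planner memo `r24/CORE-BOUND-NOTES.md` §9 R5–R9, §13; restricted-model
proof complexity — nothing here bears on `P` versus `NP`).

`PstarChordBridgeKill.regime_cases` (pnp-ideate-prover-2; pairwise killability discharged) puts a terminal core either in the (U2) corner — one chord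
read by both constraints independently — or in the DIRECTION PICTURE: a direction `m ≠ 0` carrying every read vector, every chord `e ∈ N` being (EQ)
`Q_{D e} = q_m + κ`, (EXC) `Q_{D e} = q_m + ν₁ν₂ + κ`, or (NOR) w.r.t. `q_m`.  This file assembles the per-chord structure theory of the
`PstarNorUnit*` files into ONE statement — `card_le_five_of_direction`: **in the direction picture `#J₀ ≤ 5`** — and the resulting
`regime_dichotomy`: a terminal core (well-formed liftable bridge data on a pure typed `(r,3/2)`-expanding instance with simple overlaps, `J₀`
XOR-closed with `#J₀ < r`, `#(J₀ ∪ G₁ ∪ G₂) ≤ r`, pendants off the core, `J₀ ∖ N` peelable, `N ≠ ∅`, privates unread, (T3), (M0) in every output)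
is the (U2) corner on a single cycle `J₀ = D e₀ + e₀`, or has at most five outputs.

Proof of `card_le_five_of_direction`.  Per chord `e`, the chord system supplies the (★★) containment `Z(q_m) ⊆ {Q_{D e} = γ_e + 1}`
(`PstarChordSystemMap.U1_package` + `PstarChordSystem.star_star`, as in `PstarNorUnitExc.exc_unit_of_regime`), so an (EXC) chord is (EQ) after
all or an EXC-UNIT carrying the polar formula (`PstarNorUnitExcCore.exc_unit_core`; `unit_or_EQ_of_exc`).  Then:

* (a) some chord (NOR) ⟹ every chord (NOR) (an (EQ) chord: `PstarNorUnitDirAssembly.not_EQ_of_nor_dir`; a unit: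
  `PstarNorUnitMixed.false_of_nor_of_excUnit`) ⟹ `#J₀ ≤ 5` (`PstarNorUnitFinal.card_le_five_of_regime_nor`);
* (b) no (NOR) chord, some unit `e` ⟹ `e` is not (EQ) (`PstarNorUnitMixed.not_EQ_of_excUnit`), every other unit has the same fundamental set
  (`PstarNorUnitMixed.D_eq_of_excUnits`) hence IS `e` (`PstarChordBridgeFundamental.eq_of_fundamental_eq`), and at most one chord is (EQ)
  (`PstarChordBridgeForcing.chord_eq_of_EQ`): so `N = {e}` — `J₀ = D e + e` is a triangle (`PstarNorUnitRegime.J₀_eq_of_single`) — or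
  `N = {e, e'}` with `e'` (EQ) — the unit family has `≤ 5` outputs (`PstarNorUnitMixed.card_units_le_five_of_EQ_of_excUnit`), is XOR-closed
  (`PstarNorUnitDirAssembly.xorClosed_units`) and absorbs the core (`PstarNorUnitCover.subset_units`);
* (c) every chord (EQ) ⟹ a single chord (`chord_eq_of_EQ`) = the (EQ1) corner ⟹ `#J₀ = 3` (`PstarNorUnitEQ1Three.eq1_three`).

Finally `card_le_five` closes the (U2) branch with pnp-ideate-prover-2's `PstarChordBridgeCornerUnit.card_eq_three_of_corner` (the corner is a
CONS-T triangle): **every terminal core in the sense above has at most five outputs.**  What the chain still ASSUMES upstream of the bridge data is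
Assumption A (liftable co-forest), no CROSS pendant and privates unread (memo O1/O2) — the raw-data packaging via
`PstarChordBridgeAssemble.exists_bridgeData` is left to `PstarChordBridgeFive`.
-/

set_option linter.dupNamespace false -- `Summit.PneNP.PneNP.…`: summit = sub-problem name (D-0017 single-conjunct layout)

open Finset Module Literature.Computability.Complexity
open Summit.PneNP.PneNP.Theorems.PstarTyped (Typed)
open Summit.PneNP.PneNP.Theorems.PstarSALevel (varSet bdry BoundaryExpanding SimpleOverlap)
open Summit.PneNP.PneNP.Theorems.PstarCoreBound (XorClosed)
open Summit.PneNP.PneNP.Theorems.PstarGapLinearised (andPair)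
open Summit.PneNP.PneNP.Theorems.PstarCubeIdeals (IsAffineFn)
open Summit.PneNP.PneNP.Theorems.PstarProductRank (qform polar)
open Summit.PneNP.PneNP.Theorems.PstarPathRank (AndAdj)
open Summit.PneNP.PneNP.Theorems.PstarChordSystem (ChordSystem)
open Summit.PneNP.PneNP.Theorems.PstarChordSystemMap (mapSys toX mapSys_u U1_package)
open Summit.PneNP.PneNP.Theorems.PstarChordBridgeTools (xpdeg privs)
open Summit.PneNP.PneNP.Theorems.PstarChordBridge (BridgeData sys Solution Lift sys_ρ_of_not_mem infeasible_of_not_solution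
  chordMinimal_of_solution_erase)
open Summit.PneNP.PneNP.Theorems.PstarReadSumset (V2)
open Summit.PneNP.PneNP.Theorems.PstarChordBridgeFundamental (eq_of_fundamental_eq)
open Summit.PneNP.PneNP.Theorems.PstarChordBridgeForcing (freeMon gam sys_u_eq const_of_unread chord_eq_of_EQ)
open Summit.PneNP.PneNP.Theorems.PstarChordBridgeCotree (Peelable)
open Summit.PneNP.PneNP.Theorems.PstarChordBridgeBasis (qDir polarDir q_dir)
open Summit.PneNP.PneNP.Theorems.PstarChordBridgeCorner (qDir_add)
open Summit.PneNP.PneNP.Theorems.PstarChordBridgeKill (regime_cases)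
open Summit.PneNP.PneNP.Theorems.PstarNorUnitExcCore (exc_unit_core)
open Summit.PneNP.PneNP.Theorems.PstarNorUnitMixed (not_EQ_of_excUnit false_of_nor_of_excUnit D_eq_of_excUnits
  card_units_le_five_of_EQ_of_excUnit)
open Summit.PneNP.PneNP.Theorems.PstarNorUnitDirAssembly (xorClosed_units not_EQ_of_nor_dir)
open Summit.PneNP.PneNP.Theorems.PstarNorUnitCoverTools (two_le_xpdeg_of_xorClosed)
open Summit.PneNP.PneNP.Theorems.PstarNorUnitCover (subset_units)
open Summit.PneNP.PneNP.Theorems.PstarNorUnitFinal (card_le_five_of_regime_nor)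
open Summit.PneNP.PneNP.Theorems.PstarNorUnitRegime (J₀_eq_of_single)
open Summit.PneNP.PneNP.Theorems.PstarNorUnitEQ1Three (eq1_three)
open Summit.PneNP.PneNP.Theorems.PstarChordBridgeCornerUnit (card_eq_three_of_corner)

namespace Summit.PneNP.PneNP.Theorems.PstarNorUnitDirection

variable {n m : ℕ}

/-! ## An (EXC) chord of the direction picture: (EQ) or an EXC-unit with the polar formula -/

/-- **(EXC) ⟹ (EQ) or EXC-unit, inside the chord system.**  `PstarNorUnitExcCore.exc_unit_core` against `q_m` itself, the (★★) containment
`Z(q_m) ⊆ {Q_{D e} = γ_e + 1}` being supplied by the chord system (reads on the line of `m ≠ 0`, constant reads, infeasible, chord-minimal in `e`: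
`PstarChordSystemMap.U1_package`, `PstarChordSystem.star_star`).  The unit alternative keeps exactly what the assembly uses: `D e = {j₁, j₂}` with
disjoint AND pairs, literals `σ ∈ andPair j₁`, `τ ∈ andPair j₂`, and the polar formula of direction `m`. -/
theorem unit_or_EQ_of_exc (I : LocalMap 4 n m) (hI : I.IsPure xorAndPred) (hS : SimpleOverlap I) {r : ℕ} (hB : BoundaryExpanding r I)
    {B : BridgeData n m} (hW : B.WF I) (hr : (B.J₀ ∪ B.G₁ ∪ B.G₂).card ≤ r) {e : Fin m} (he : e ∈ B.N) (heG : e ∉ B.G₁ ∪ B.G₂)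
    {mv : V2} (hmv : mv ≠ 0)
    (hU1 : ∀ e' a, ((sys I B).ρ e' a = 0 ∨ (sys I B).ρ e' a = mv) ∧ ((sys I B).ρ' e' a = 0 ∨ (sys I B).ρ' e' a = mv))
    (hconst : ∀ e' a a', (sys I B).ρ e' a = (sys I B).ρ e' a' ∧ (sys I B).ρ' e' a = (sys I B).ρ' e' a')
    (hinf : (sys I B).Infeasible B.N) (hmin : (sys I B).ChordMinimal B.N e)
    {μ₁ μ₂ : (Fin n → ZMod 2) → ZMod 2} (hμ₁ : IsAffineFn μ₁) (hμ₂ : IsAffineFn μ₂) {κ : ZMod 2}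
    (hEXC : ∀ x, qform (B.D e) (fun j => I.vars j 2) (fun j => I.vars j 3) x = qDir I B mv x + μ₁ x * μ₂ x + κ) :
    (∃ κ' : ZMod 2, ∀ x, qform (B.D e) (fun j => I.vars j 2) (fun j => I.vars j 3) x = qDir I B mv x + κ') ∨
    (∃ j₁ j₂ : Fin m, ∃ σ τ : Fin n, j₁ ≠ j₂ ∧ B.D e = {j₁, j₂} ∧ Disjoint (andPair I j₁) (andPair I j₂) ∧
      σ ∈ andPair I j₁ ∧ τ ∈ andPair I j₂ ∧
      ∀ v w : Fin n, polarDir I B mv (Pi.single v 1) (Pi.single w 1) =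
        (if AndAdj I (B.D e) v w then 1 else 0) + (if (v = σ ∧ w = τ) ∨ (v = τ ∧ w = σ) then 1 else 0)) := by
  obtain ⟨hSR, hinf', hmin', hconst'⟩ := U1_package (sys I B) hinf hmv hU1 hconst
  have hstar := (mapSys (sys I B) (toX mv)).star_star hSR hconst' hinf' he (hmin' e hmin)
  have hZ : ∀ x, qDir I B mv x = 0 → qform (B.D e) (fun j => I.vars j 2) (fun j => I.vars j 3) x = gam B e + 1 := by
    intro x hx
    have hZx : ((mapSys (sys I B) (toX mv)).F x).2 = (mapSys (sys I B) (toX mv)).t.2 := by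
      have h := q_dir I B mv x
      rw [hx] at h
      have e2 : ∀ a b : ZMod 2, a + b = 0 → a = b := by decide
      exact e2 _ _ h
    have h1 := hstar x hZx
    rw [mapSys_u, sys_u_eq I B e x] at h1
    have e1 : ∀ g Q : ZMod 2, g + Q = 1 → Q = g + 1 := by decide
    exact e1 _ _ h1
  rcases exc_unit_core I hI hS hB hW hr he heG mv (qDir_add I B mv) hZ hμ₁ hμ₂ hEXC with
      h | ⟨j₁, j₂, σ, τ, hne, hDe, hdisj, hσ, hτ, -, hform, -⟩
  · exact Or.inl h
  · exact Or.inr ⟨j₁, j₂, σ, τ, hne, hDe, hdisj, hσ, hτ, hform⟩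

/-! ## The direction picture has at most five outputs -/

/-- **In the direction picture `#J₀ ≤ 5`.**  Hypotheses: those of `PstarNorUnitEQ1Three.regime_trichotomy_exc` (terminal-core package) plus the
direction data of the second disjunct of `PstarChordBridgeKill.regime_cases` VERBATIM (`m ≠ 0`, all chord reads on the line of `m`, every chord
(EQ) / (EXC) / (NOR) w.r.t. `q_m`).  See the module docstring for the case analysis. -/
theorem card_le_five_of_direction (I : LocalMap 4 n m) (hI : I.IsPure xorAndPred) (hT : Typed I) (hS : SimpleOverlap I) {r : ℕ}
    (hB : BoundaryExpanding r I) {B : BridgeData n m} (hW : B.WF I) (hJr : B.J₀.card < r) (hr : (B.J₀ ∪ B.G₁ ∪ B.G₂).card ≤ r)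
    (hX : XorClosed I B.J₀) (hP : Peelable I (B.J₀ \ B.N)) (hG₁ : Disjoint B.G₁ B.J₀) (hG₂ : Disjoint B.G₂ B.J₀) (hN : B.N.Nonempty)
    (hL : Lift I B)
    (hun : ∀ v ∈ privs I B.N, (∀ g ∈ B.G₁, I.vars g 2 ≠ v ∧ I.vars g 3 ≠ v) ∧ ∀ g ∈ B.G₂, I.vars g 2 ≠ v ∧ I.vars g 3 ≠ v)
    (hT3 : ¬ ∃ z, Solution I B B.J₀ z) (hM0 : ∀ f ∈ B.J₀, ∃ z, Solution I B (B.J₀.erase f) z)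
    {mv : V2} (hmv : mv ≠ 0)
    (hreads : ∀ e ∈ B.N, ((sys I B).ρ e 0 = 0 ∨ (sys I B).ρ e 0 = mv) ∧ ((sys I B).ρ' e 0 = 0 ∨ (sys I B).ρ' e 0 = mv))
    (hall : ∀ e ∈ B.N,
      (∃ κ : ZMod 2, ∀ x, qform (B.D e) (fun j => I.vars j 2) (fun j => I.vars j 3) x = qDir I B mv x + κ) ∨
      (∃ ν₁ ν₂ : (Fin n → ZMod 2) → ZMod 2, IsAffineFn ν₁ ∧ IsAffineFn ν₂ ∧ ∃ κ : ZMod 2, ∀ x,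
        qform (B.D e) (fun j => I.vars j 2) (fun j => I.vars j 3) x = qDir I B mv x + ν₁ x * ν₂ x + κ) ∨
      (∃ a b : Fin n → ZMod 2, polarDir I B mv a b = 1 ∧
        (∀ x, qDir I B mv x =
          (polarDir I B mv x b + (qDir I B mv b + qDir I B mv 0)) * (polarDir I B mv x a + (qDir I B mv a + qDir I B mv 0)) + 1) ∧
        ∃ m₁ m₂ : (Fin n → ZMod 2) → ZMod 2, IsAffineFn m₁ ∧ IsAffineFn m₂ ∧
          ∀ x, qform (B.D e) (fun j => I.vars j 2) (fun j => I.vars j 3) x + (gam B e + 1) =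
            (polarDir I B mv x b + (qDir I B mv b + qDir I B mv 0) + 1) * m₁ x +
            (polarDir I B mv x a + (qDir I B mv a + qDir I B mv 0) + 1) * m₂ x)) :
    B.J₀.card ≤ 5 := by
  classical
  -- the model
  have hinf : (sys I B).Infeasible B.N := infeasible_of_not_solution I hI hT hW hL hT3
  have hmin : ∀ e ∈ B.N, (sys I B).ChordMinimal B.N e := fun e he => by
    obtain ⟨z, hz⟩ := hM0 e (hW.hN he)
    exact chordMinimal_of_solution_erase I hI hT hW he hz
  have hconst := const_of_unread I B hun
  have hU1 : ∀ e a, ((sys I B).ρ e a = 0 ∨ (sys I B).ρ e a = mv) ∧ ((sys I B).ρ' e a = 0 ∨ (sys I B).ρ' e a = mv) := by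
    intro e a
    by_cases he : e ∈ B.N
    · rw [(hconst e a 0).1, (hconst e a 0).2]; exact hreads e he
    · rw [(sys_ρ_of_not_mem I B he a).1, (sys_ρ_of_not_mem I B he a).2]; exact ⟨Or.inl rfl, Or.inl rfl⟩
  have heG : ∀ e ∈ B.N, e ∉ B.G₁ ∪ B.G₂ := fun e he h => by
    rcases mem_union.1 h with h | h
    · exact Finset.disjoint_left.1 hG₁ h (hW.hN he)
    · exact Finset.disjoint_left.1 hG₂ h (hW.hN he)
  have hqB : ∀ x w, qDir I B mv (x + w) = qDir I B mv x + qDir I B mv w + qDir I B mv 0 + polarDir I B mv x w := qDir_add I B mv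
  -- per chord: (EQ) / EXC-unit / (NOR)
  have hcls : ∀ e ∈ B.N,
      (∃ κ : ZMod 2, ∀ x, qform (B.D e) (fun j => I.vars j 2) (fun j => I.vars j 3) x = qDir I B mv x + κ) ∨
      (∃ j₁ j₂ : Fin m, ∃ σ τ : Fin n, j₁ ≠ j₂ ∧ B.D e = {j₁, j₂} ∧ Disjoint (andPair I j₁) (andPair I j₂) ∧
        σ ∈ andPair I j₁ ∧ τ ∈ andPair I j₂ ∧
        ∀ v w : Fin n, polarDir I B mv (Pi.single v 1) (Pi.single w 1) =
          (if AndAdj I (B.D e) v w then 1 else 0) + (if (v = σ ∧ w = τ) ∨ (v = τ ∧ w = σ) then 1 else 0)) ∨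
      (∃ a b : Fin n → ZMod 2, polarDir I B mv a b = 1 ∧
        (∀ x, qDir I B mv x =
          (polarDir I B mv x b + (qDir I B mv b + qDir I B mv 0)) * (polarDir I B mv x a + (qDir I B mv a + qDir I B mv 0)) + 1) ∧
        ∃ m₁ m₂ : (Fin n → ZMod 2) → ZMod 2, IsAffineFn m₁ ∧ IsAffineFn m₂ ∧
          ∀ x, qform (B.D e) (fun j => I.vars j 2) (fun j => I.vars j 3) x + (gam B e + 1) =
            (polarDir I B mv x b + (qDir I B mv b + qDir I B mv 0) + 1) * m₁ x +
            (polarDir I B mv x a + (qDir I B mv a + qDir I B mv 0) + 1) * m₂ x) := by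
    intro e he
    rcases hall e he with h | ⟨ν₁, ν₂, hν₁, hν₂, κ, h⟩ | h
    · exact Or.inl h
    · rcases unit_or_EQ_of_exc I hI hS hB hW hr he (heG e he) hmv hU1 hconst hinf (hmin e he) hν₁ hν₂ h with h' | h'
      · exact Or.inl h'
      · exact Or.inr (Or.inl h')
    · exact Or.inr (Or.inr h)
  -- (a) some (NOR) chord ⟹ every chord (NOR)
  by_cases hNOR : ∃ e ∈ B.N, ∃ a b : Fin n → ZMod 2, polarDir I B mv a b = 1 ∧
      (∀ x, qDir I B mv x =
        (polarDir I B mv x b + (qDir I B mv b + qDir I B mv 0)) * (polarDir I B mv x a + (qDir I B mv a + qDir I B mv 0)) + 1) ∧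
      ∃ m₁ m₂ : (Fin n → ZMod 2) → ZMod 2, IsAffineFn m₁ ∧ IsAffineFn m₂ ∧
        ∀ x, qform (B.D e) (fun j => I.vars j 2) (fun j => I.vars j 3) x + (gam B e + 1) =
          (polarDir I B mv x b + (qDir I B mv b + qDir I B mv 0) + 1) * m₁ x +
          (polarDir I B mv x a + (qDir I B mv a + qDir I B mv 0) + 1) * m₂ x
  · obtain ⟨e₁, he₁, a₁, b₁, -, hq₁, -⟩ := hNOR
    refine card_le_five_of_regime_nor I hI hT hS hB hW hr hJr hX hP hG₁ hG₂ hN mv fun e he => ?_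
    rcases hcls e he with ⟨κ, hκ⟩ | ⟨j₁, j₂, σ, τ, -, hDe, hdisj, hσ, hτ, hform⟩ | h
    · exact (not_EQ_of_nor_dir I hI hS hB hW hJr.le mv hq₁ he hκ).elim
    · exact (false_of_nor_of_excUnit I hI hDe hdisj hσ hτ hform hq₁).elim
    · exact h
  -- (b) no (NOR) chord, some EXC-unit `e`
  by_cases hUNIT : ∃ e ∈ B.N, ∃ j₁ j₂ : Fin m, ∃ σ τ : Fin n, j₁ ≠ j₂ ∧ B.D e = {j₁, j₂} ∧ Disjoint (andPair I j₁) (andPair I j₂) ∧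
      σ ∈ andPair I j₁ ∧ τ ∈ andPair I j₂ ∧
      ∀ v w : Fin n, polarDir I B mv (Pi.single v 1) (Pi.single w 1) =
        (if AndAdj I (B.D e) v w then 1 else 0) + (if (v = σ ∧ w = τ) ∨ (v = τ ∧ w = σ) then 1 else 0)
  · obtain ⟨e, he, j₁, j₂, σ, τ, hne, hDe, hdisj, hσ, hτ, hform⟩ := hUNIT
    have heD : e ∉ B.D e := fun h => (mem_sdiff.1 (hW.hD e he h)).2 he
    -- every other chord is (EQ)
    have hother : ∀ e' ∈ B.N, e' ≠ e →
        ∃ κ : ZMod 2, ∀ x, qform (B.D e') (fun j => I.vars j 2) (fun j => I.vars j 3) x = qDir I B mv x + κ := by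
      intro e' he' hne'
      rcases hcls e' he' with h | ⟨k₁, k₂, σ', τ', hne'', hDe', hdisj', hσ', hτ', hform'⟩ | h
      · exact h
      · -- a second unit has the same fundamental set, hence is `e`
        exfalso
        have hDD : B.D e' = B.D e := D_eq_of_excUnits I hI hS hDe hdisj hσ hτ hform hne'' hDe' hdisj' hσ' hτ' hform'
        have he'D : e' ∉ B.D e := fun h => (mem_sdiff.1 (hW.hD e' he' (hDD ▸ h))).2 he'
        have heven' : ∀ w, Even (xpdeg I (insert e' (B.D e)) w) := fun w => by
          have h := hW.hDeven e' he' w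
          rwa [hDD] at h
        exact hne' (eq_of_fundamental_eq I hI hS he'D heD heven' (hW.hDeven e he))
      · exact absurd ⟨e', he', h⟩ hNOR
    by_cases hsingle : ∀ e' ∈ B.N, e' = e
    · -- `N = {e}`: the core is the triangle `D e + e`
      have hNe : B.N = {e} := eq_singleton_iff_unique_mem.2 ⟨he, hsingle⟩
      have h3 : B.J₀.card = 3 := by
        rw [J₀_eq_of_single I hI hT hW hX hP hNe, card_insert_of_notMem heD, hDe, card_pair hne]
      omega
    · -- `N = {e, e'}` with `e'` (EQ): the unit family has `≤ 5` outputs and absorbs the core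
      push Not at hsingle
      obtain ⟨e', he', hne'⟩ := hsingle
      obtain ⟨κ', hκ'⟩ := hother e' he' hne'
      have hNe : B.N = {e, e'} := by
        refine Subset.antisymm (fun f hf => ?_) fun f hf => ?_
        · rw [mem_insert, mem_singleton]
          by_cases hfe : f = e
          · exact Or.inl hfe
          · obtain ⟨κf, hκf⟩ := hother f hf hfe
            exact Or.inr (chord_eq_of_EQ I hI hS hW hf he' hκf hκ')
        · rw [mem_insert, mem_singleton] at hf
          rcases hf with rfl | rfl
          · exact he
          · exact he'
      have h5 := card_units_le_five_of_EQ_of_excUnit I hI hS hDe hdisj hσ hτ hform hqB hκ' hNe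
      exact le_trans (card_le_card (subset_units I hI hS hW.hN hP hW.hD hW.hDeven (two_le_xpdeg_of_xorClosed I hT hX)
        (two_le_xpdeg_of_xorClosed I hT (xorClosed_units I hI hW)) h5)) h5
  -- (c) every chord (EQ): a single chord, the (EQ1) corner
  have hEQ : ∀ e ∈ B.N, ∃ κ : ZMod 2, ∀ x, qform (B.D e) (fun j => I.vars j 2) (fun j => I.vars j 3) x = qDir I B mv x + κ := by
    intro e he
    rcases hcls e he with h | h | h
    · exact h
    · exact absurd ⟨e, he, h⟩ hUNIT
    · exact absurd ⟨e, he, h⟩ hNOR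
  obtain ⟨e₁, he₁⟩ := hN
  obtain ⟨κ₁, hκ₁⟩ := hEQ e₁ he₁
  have hNe : B.N = {e₁} := by
    refine eq_singleton_iff_unique_mem.2 ⟨he₁, fun e he => ?_⟩
    obtain ⟨κ, hκ⟩ := hEQ e he
    exact chord_eq_of_EQ I hI hS hW he he₁ hκ hκ₁
  have h3 := eq1_three I hI hT hS hB hW hr hX hP hG₁ hG₂ hL hun hT3 hM0 hmv hreads hNe hκ₁
  omega

/-! ## The dichotomy -/

/-- **Regime dichotomy of a terminal core: the (U2) corner on a single cycle, or at most five outputs.**  `PstarChordBridgeKill.regime_cases`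
(pairwise killability discharged) followed by `card_le_five_of_direction` in the direction picture and `PstarNorUnitRegime.J₀_eq_of_single` in the
(U2) corner.  Hypotheses: pure typed `(r,3/2)`-expanding instance with simple overlaps; well-formed bridge data with the lift property; `J₀`
XOR-closed, `#J₀ < r`, `#(J₀ ∪ G₁ ∪ G₂) ≤ r`; pendants off the core; `J₀ ∖ N` peelable; `N ≠ ∅`; no pendant reads a private; the terminal system
unsolvable (T3) but solvable after deleting any single output (M0). -/
theorem regime_dichotomy (I : LocalMap 4 n m) (hI : I.IsPure xorAndPred) (hT : Typed I) (hS : SimpleOverlap I) {r : ℕ}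
    (hB : BoundaryExpanding r I) {B : BridgeData n m} (hW : B.WF I) (hJr : B.J₀.card < r) (hr : (B.J₀ ∪ B.G₁ ∪ B.G₂).card ≤ r)
    (hX : XorClosed I B.J₀) (hP : Peelable I (B.J₀ \ B.N)) (hG₁ : Disjoint B.G₁ B.J₀) (hG₂ : Disjoint B.G₂ B.J₀) (hN : B.N.Nonempty)
    (hL : Lift I B)
    (hun : ∀ v ∈ privs I B.N, (∀ g ∈ B.G₁, I.vars g 2 ≠ v ∧ I.vars g 3 ≠ v) ∧ ∀ g ∈ B.G₂, I.vars g 2 ≠ v ∧ I.vars g 3 ≠ v)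
    (hT3 : ¬ ∃ z, Solution I B B.J₀ z) (hM0 : ∀ f ∈ B.J₀, ∃ z, Solution I B (B.J₀.erase f) z) :
    (∃ e₀, B.N = {e₀} ∧ B.J₀ = insert e₀ (B.D e₀) ∧
      (sys I B).ρ e₀ 0 ≠ 0 ∧ (sys I B).ρ' e₀ 0 ≠ 0 ∧ (sys I B).ρ e₀ 0 ≠ (sys I B).ρ' e₀ 0) ∨
    B.J₀.card ≤ 5 := by
  rcases regime_cases I hI hT hS hB hW hJr.le hL hun hT3 (fun e he => hM0 e (hW.hN he)) with
      ⟨e₀, hNe, h1, h2, h3⟩ | ⟨mv, hmv, hreads, hall⟩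
  · exact Or.inl ⟨e₀, hNe, J₀_eq_of_single I hI hT hW hX hP hNe, h1, h2, h3⟩
  · exact Or.inr (card_le_five_of_direction I hI hT hS hB hW hJr hr hX hP hG₁ hG₂ hN hL hun hT3 hM0 hmv hreads hall)

/-- **Every terminal core has at most five outputs.**  `regime_dichotomy` with its (U2) branch closed by pnp-ideate-prover-2's
`PstarChordBridgeCornerUnit.card_eq_three_of_corner` (the corner is a CONS-T triangle).  Hypotheses exactly those of `regime_dichotomy`. -/
theorem card_le_five (I : LocalMap 4 n m) (hI : I.IsPure xorAndPred) (hT : Typed I) (hS : SimpleOverlap I) {r : ℕ}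
    (hB : BoundaryExpanding r I) {B : BridgeData n m} (hW : B.WF I) (hJr : B.J₀.card < r) (hr : (B.J₀ ∪ B.G₁ ∪ B.G₂).card ≤ r)
    (hX : XorClosed I B.J₀) (hP : Peelable I (B.J₀ \ B.N)) (hG₁ : Disjoint B.G₁ B.J₀) (hG₂ : Disjoint B.G₂ B.J₀) (hN : B.N.Nonempty)
    (hL : Lift I B)
    (hun : ∀ v ∈ privs I B.N, (∀ g ∈ B.G₁, I.vars g 2 ≠ v ∧ I.vars g 3 ≠ v) ∧ ∀ g ∈ B.G₂, I.vars g 2 ≠ v ∧ I.vars g 3 ≠ v)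
    (hT3 : ¬ ∃ z, Solution I B B.J₀ z) (hM0 : ∀ f ∈ B.J₀, ∃ z, Solution I B (B.J₀.erase f) z) : B.J₀.card ≤ 5 := by
  rcases regime_dichotomy I hI hT hS hB hW hJr hr hX hP hG₁ hG₂ hN hL hun hT3 hM0 with ⟨e₀, hNe, hJ, h1, h2, h3⟩ | h
  · have h3' := card_eq_three_of_corner I hI hT hS hB hW hr hG₁ hG₂ hL hun hT3 hM0 hNe hJ h1 h2 h3
    omega
  · exact h

end Summit.PneNP.PneNP.Theorems.PstarNorUnitDirection
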